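import Summits.Schanuel.Schanuel.Theorems.ZilberEacComplexPunctureDecouplingLemmas
import Mathlib.Analysis.SpecialFunctions.Pow.Asymptotics
import Mathlib.Analysis.SpecialFunctions.Pow.Real
import Mathlib.Analysis.SpecialFunctions.Complex.Log
import HarnessLib

/-!
# The cancelling-fibre regime: two-scale labels and the smallness of the seven parameters

Zilber's Exponential-Algebraic Closedness, case ladder (host summit Schanuel, cell `pub-schanuel`,
seat 2, gen 15).  THE FAMILY (`r₀ ≠ 0`, `r₁ ∈ ℝ`, `c ∈ ℂ`, `F₀ ≠ 0`, `F₁` arbitrary):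

  `W = {x₂ = r₀x₀ + r₁x₁ + c,  y₀ = x₀ + y₂F₀(y₂),  y₁ = x₁ + y₂F₁(y₂)} ⊆ ℂ³ × ℂ³`,

exponential points `e^{xⱼ} = xⱼ + y₂Fⱼ(y₂)`, `y₂ = e^{x₂}`.  THE NEW REGIME (super-critical sizes,
O57/O58 (a) of the cell's census): the fibre `j = 1` is SLOW (`x₁ = Log(2πim) + 2πim + u₁`), the
fibre `j = 0` is CANCELLING — `x₀ ≈ -y₂F₀(y₂)` with `e^{x₀}` negligible against `y₂F₀(y₂)` — and
the base value `x₂ = 2πik' + (τ + u₂)/e₀` carries a SECOND, independent label `k' ∈ ℤ` through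
`K = r₁m - k' ≍ m^β` (`e₀ = deg F₀ + 1`, `a₀ = lc F₀`, `τ = Log(2πiK/(r₀a₀))`, so that
`r₀a₀e^{e₀x₂} ≈ 2πiK`).  After division by `2πiK` and `2πim` the two fibre equations become an
ENTIRE system in `(u₁, u₂)` and seven small parameters

  `σ = e^{-τ/e₀}`, `μ = 1/(2πiK)`, `ν = μ(τ/e₀ - r₁Log(2πim) - c)`, `η = r₀μe^{x₀ᶜ}`,
  `μ₁ = 1/(2πim)`, `ν₁ = μ₁Log(2πim)`, `θ = μ₁e^{e₁τ/e₀}`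

(`x₀ᶜ = (-2πiK + τ/e₀ - r₁Log(2πim) - c)/r₀`, `e₁ = deg F₁ + 1`), whose limit at parameter `0` is
`e^{u₂} = 1`, `e^{u₁} = 1`.  This file: the two-scale labels (`floorLabel_bounds`, the sandwich
`m^β ≤ K ≤ m^β + 1` and its logarithmic form), the decay lemma `tendsto_exp_affine_log`
(`e^{a + b log K + c log m} → 0` when `bβ + c < 0`), and the seven limits `→ 0`; the exponent
conditions are `β > 0` (σ, μ, ν), `βe₁ < e₀` (θ) and `(β/e₀ - r₁)/r₀ < β` (η: the cancelling
condition `|e^{x₀}| = o(|y₂F₀(y₂)|)`).  The implicit-function continuation is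
`ZilberEacCancellingFibreExistence`; density is `ZilberEacCancellingFibreDensity`.

HONEST FRAMING: estimates for explicit members of an OPEN cell (`ECCell 3 2`); NOT Schanuel's
conjecture; EAC ⇏ SC.
-/

noncomputable section

open Complex Filter Topology Asymptotics

set_option linter.dupNamespace false

namespace Summit.Schanuel.Schanuel.Theorems

/-! ## Part A. Two-scale labels -/

section Labels

/-- **The second label.**  `K = r₁m - ⌊r₁m - m^β⌋` lies in `[m^β, m^β + 1]`. [folklore] -/
theorem floorLabel_bounds (r₁ β : ℝ) (m : ℕ) :
    (m : ℝ) ^ β ≤ r₁ * m - (⌊r₁ * m - (m : ℝ) ^ β⌋ : ℤ) ∧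
      r₁ * m - (⌊r₁ * m - (m : ℝ) ^ β⌋ : ℤ) ≤ (m : ℝ) ^ β + 1 := by
  constructor
  · have := Int.floor_le (r₁ * m - (m : ℝ) ^ β); linarith
  · have := Int.lt_floor_add_one (r₁ * m - (m : ℝ) ^ β); linarith

variable {β : ℝ} {K : ℕ → ℝ}

/-- `K ≥ 1` for `m ≥ 1`. [folklore] -/
theorem one_le_of_rpow_le (hβ : 0 < β) (hK : ∀ m : ℕ, (m : ℝ) ^ β ≤ K m) {m : ℕ} (hm : 1 ≤ m) :
    1 ≤ K m :=
  (Real.one_le_rpow (by exact_mod_cast hm) hβ.le).trans (hK m)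

/-- `K → ∞`. [folklore] -/
theorem tendsto_atTop_of_rpow_le (hβ : 0 < β) (hK : ∀ m : ℕ, (m : ℝ) ^ β ≤ K m) :
    Tendsto K atTop atTop :=
  tendsto_atTop_mono hK ((tendsto_rpow_atTop hβ).comp tendsto_natCast_atTop_atTop)

/-- The logarithmic sandwich `β log m ≤ log K ≤ β log m + log 2`. [folklore] -/
theorem log_sandwich (hβ : 0 < β) (hK : ∀ m : ℕ, (m : ℝ) ^ β ≤ K m ∧ K m ≤ (m : ℝ) ^ β + 1)
    {m : ℕ} (hm : 1 ≤ m) :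
    β * Real.log m ≤ Real.log (K m) ∧ Real.log (K m) ≤ β * Real.log m + Real.log 2 := by
  have hm' : (1 : ℝ) ≤ m := by exact_mod_cast hm
  have hmpos : (0 : ℝ) < m := by linarith
  have hpow1 : 1 ≤ (m : ℝ) ^ β := Real.one_le_rpow hm' hβ.le
  have hpowpos : 0 < (m : ℝ) ^ β := by linarith
  rw [← Real.log_rpow hmpos]
  refine ⟨Real.log_le_log hpowpos (hK m).1, ?_⟩
  rw [← Real.log_mul hpowpos.ne' two_ne_zero]
  exact Real.log_le_log (by linarith [(hK m).1]) (by linarith [(hK m).2])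

/-- **Decay lemma.**  `e^{a + b log K + c log m} → 0` whenever `bβ + c < 0`. [folklore] -/
theorem tendsto_exp_affine_log (hβ : 0 < β)
    (hK : ∀ m : ℕ, (m : ℝ) ^ β ≤ K m ∧ K m ≤ (m : ℝ) ^ β + 1) (a b c : ℝ) (h : b * β + c < 0) :
    Tendsto (fun m : ℕ => Real.exp (a + b * Real.log (K m) + c * Real.log m)) atTop (𝓝 0) := by
  have hup : Tendsto (fun m : ℕ => Real.exp (a + |b| * Real.log 2 + (b * β + c) * Real.log m))
      atTop (𝓝 0) := by
    refine Real.tendsto_exp_atBot.comp ?_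
    have hlog : Tendsto (fun m : ℕ => Real.log m) atTop atTop :=
      Real.tendsto_log_atTop.comp tendsto_natCast_atTop_atTop
    exact tendsto_atBot_add_const_left _ _ (hlog.const_mul_atTop_of_neg h)
  refine squeeze_zero' (Eventually.of_forall fun m => (Real.exp_pos _).le) ?_ hup
  filter_upwards [eventually_ge_atTop 1] with m hm
  obtain ⟨h1, h2⟩ := log_sandwich hβ hK hm
  refine Real.exp_le_exp.2 ?_
  have hd : |b * (Real.log (K m) - β * Real.log m)| ≤ |b| * Real.log 2 := by
    rw [abs_mul]
    refine mul_le_mul_of_nonneg_left ?_ (abs_nonneg _)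
    rw [abs_of_nonneg (by linarith)]
    linarith
  have hsplit : b * Real.log (K m) = b * β * Real.log m + b * (Real.log (K m) - β * Real.log m) := by
    ring
  have := (abs_le.1 hd).2
  rw [hsplit]
  nlinarith [this]

/-- `log K / K → 0`. [folklore] -/
theorem tendsto_log_div_label (hβ : 0 < β) (hK : ∀ m : ℕ, (m : ℝ) ^ β ≤ K m) :
    Tendsto (fun m => Real.log (K m) / K m) atTop (𝓝 0) :=
  (Real.isLittleO_log_id_atTop.comp_tendsto (tendsto_atTop_of_rpow_le hβ hK)).tendsto_div_nhds_zero

/-- `log m / K → 0`. [folklore] -/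
theorem tendsto_log_nat_div_label (hβ : 0 < β) (hK : ∀ m : ℕ, (m : ℝ) ^ β ≤ K m) :
    Tendsto (fun m : ℕ => Real.log m / K m) atTop (𝓝 0) := by
  have h1 : Tendsto (fun m : ℕ => Real.log m / (m : ℝ) ^ β) atTop (𝓝 0) :=
    ((isLittleO_log_rpow_atTop hβ).comp_tendsto tendsto_natCast_atTop_atTop).tendsto_div_nhds_zero
  refine squeeze_zero' ?_ ?_ h1
  · filter_upwards [eventually_ge_atTop 1] with m hm
    exact div_nonneg (Real.log_nonneg (by exact_mod_cast hm))
      (by linarith [one_le_of_rpow_le hβ hK hm])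
  · filter_upwards [eventually_ge_atTop 1] with m hm
    exact div_le_div_of_nonneg_left (Real.log_nonneg (by exact_mod_cast hm))
      (Real.rpow_pos_of_pos (by exact_mod_cast hm) β) (hK m)

/-- `C / K → 0`. [folklore] -/
theorem tendsto_const_div_label (hβ : 0 < β) (hK : ∀ m : ℕ, (m : ℝ) ^ β ≤ K m) (C : ℝ) :
    Tendsto (fun m => C / K m) atTop (𝓝 0) :=
  tendsto_const_nhds.div_atTop (tendsto_atTop_of_rpow_le hβ hK)

end Labels

/-! ## Part B. Real parts and norms of the building blocks -/

section Blocks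

/-- `‖2πiK/(r₀a₀)‖ = 2πK/(|r₀|‖a₀‖)` for `K ≥ 0`. [folklore] -/
theorem norm_label_quot {K r₀ : ℝ} (hK : 0 ≤ K) (a₀ : ℂ) :
    ‖2 * Real.pi * I * (K : ℂ) / ((r₀ : ℂ) * a₀)‖ = 2 * Real.pi / (|r₀| * ‖a₀‖) * K := by
  rw [norm_div, norm_mul, norm_mul, norm_mul, norm_mul, Complex.norm_I, mul_one, Complex.norm_real,
    Complex.norm_real, Complex.norm_real, Complex.norm_two, Real.norm_of_nonneg Real.pi_pos.le,
    Real.norm_of_nonneg hK, Real.norm_eq_abs]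
  ring

/-- `Re Log(2πiK/(r₀a₀)) = log(2π/(|r₀|‖a₀‖)) + log K` for `K > 0`, `r₀ ≠ 0`, `a₀ ≠ 0`. [folklore] -/
theorem re_log_label_quot {K r₀ : ℝ} (hK : 0 < K) (hr₀ : r₀ ≠ 0) {a₀ : ℂ} (ha₀ : a₀ ≠ 0) :
    (Complex.log (2 * Real.pi * I * (K : ℂ) / ((r₀ : ℂ) * a₀))).re =
      Real.log (2 * Real.pi / (|r₀| * ‖a₀‖)) + Real.log K := by
  rw [Complex.log_re, norm_label_quot hK.le, Real.log_mul _ hK.ne']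
  have : 0 < 2 * Real.pi / (|r₀| * ‖a₀‖) :=
    div_pos (by positivity) (mul_pos (abs_pos.2 hr₀) (norm_pos_iff.2 ha₀))
  exact this.ne'

/-- `‖2πim‖ = 2πm`. [folklore] -/
theorem norm_two_pi_I_mul_natCast (m : ℕ) : ‖2 * Real.pi * I * (m : ℂ)‖ = 2 * Real.pi * m := by
  rw [norm_mul, norm_mul, norm_mul, Complex.norm_I, mul_one, Complex.norm_real, Complex.norm_two,
    Real.norm_of_nonneg Real.pi_pos.le, Complex.norm_natCast]

/-- `Re Log(2πim) = log(2πm)`. [folklore] -/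
theorem re_log_two_pi_I_mul_natCast (m : ℕ) :
    (Complex.log (2 * Real.pi * I * (m : ℂ))).re = Real.log (2 * Real.pi * m) := by
  rw [Complex.log_re, norm_two_pi_I_mul_natCast]

/-- `Re(2πiK) = 0`. [folklore] -/
theorem re_two_pi_I_mul_ofReal (K : ℝ) : (2 * Real.pi * I * (K : ℂ)).re = 0 := by
  simp [Complex.mul_re, Complex.mul_im]

/-- `‖Log(2πim)‖ ≤ log(2πm) + π` for `m ≥ 1`. [folklore] -/
theorem norm_log_two_pi_I_mul_natCast_le {m : ℕ} (hm : 1 ≤ m) :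
    ‖Complex.log (2 * Real.pi * I * (m : ℂ))‖ ≤ Real.log (2 * Real.pi * m) + Real.pi := by
  have h1 : 1 ≤ ‖2 * Real.pi * I * (m : ℂ)‖ := by
    rw [norm_two_pi_I_mul_natCast]
    have hm' : (1 : ℝ) ≤ m := by exact_mod_cast hm
    nlinarith [Real.two_le_pi]
  have := norm_log_le_log_norm_add_pi h1
  rwa [norm_two_pi_I_mul_natCast] at this

/-- `q⁻¹ e^{B} = e^{-log q + B}` for `q > 0`. [folklore] -/
theorem inv_mul_exp_eq_exp {q : ℝ} (hq : 0 < q) (B : ℝ) :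
    q⁻¹ * Real.exp B = Real.exp (-Real.log q + B) := by
  rw [Real.exp_add, Real.exp_neg, Real.exp_log hq]

/-- `p q⁻¹ e^{B} = e^{log p - log q + B}` for `p, q > 0`. [folklore] -/
theorem mul_inv_mul_exp_eq_exp {p q : ℝ} (hp : 0 < p) (hq : 0 < q) (B : ℝ) :
    p * q⁻¹ * Real.exp B = Real.exp (Real.log p - Real.log q + B) := by
  rw [Real.exp_add, Real.exp_sub, Real.exp_log hp, Real.exp_log hq, div_eq_mul_inv]

end Blocks

/-! ## Part C. The seven parameters tend to zero -/

section Params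

variable {β : ℝ} {K : ℕ → ℝ} (hβ : 0 < β)
  (hK : ∀ m : ℕ, (m : ℝ) ^ β ≤ K m ∧ K m ≤ (m : ℝ) ^ β + 1)
  {r₀ : ℝ} (hr₀ : r₀ ≠ 0) {a₀ : ℂ} (ha₀ : a₀ ≠ 0)

/-- `μ₁ = 1/(2πim) → 0`. [folklore] -/
theorem tendsto_param_mu₁ : Tendsto (fun m : ℕ => (2 * Real.pi * I * (m : ℂ))⁻¹) atTop (𝓝 0) := by
  rw [tendsto_zero_iff_norm_tendsto_zero]
  have h : Tendsto (fun m : ℕ => ‖2 * Real.pi * I * (m : ℂ)‖) atTop atTop := by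
    simp_rw [norm_two_pi_I_mul_natCast]
    exact tendsto_natCast_atTop_atTop.const_mul_atTop (by positivity)
  refine (h.inv_tendsto_atTop).congr fun m => ?_
  simp only [Pi.inv_apply, norm_inv]

/-- `ν₁ = Log(2πim)/(2πim) → 0`. [folklore] -/
theorem tendsto_param_nu₁ :
    Tendsto (fun m : ℕ => (2 * Real.pi * I * (m : ℂ))⁻¹ * Complex.log (2 * Real.pi * I * (m : ℂ)))
      atTop (𝓝 0) := by
  have h2pm : Tendsto (fun m : ℕ => 2 * Real.pi * (m : ℝ)) atTop atTop :=
    tendsto_natCast_atTop_atTop.const_mul_atTop (by positivity)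
  have hup : Tendsto (fun m : ℕ => (Real.log (2 * Real.pi * m) + Real.pi) / (2 * Real.pi * m)) atTop
      (𝓝 0) := (tendsto_log_add_const_div_atTop Real.pi).comp h2pm
  refine squeeze_zero_norm' ?_ hup
  filter_upwards [eventually_ge_atTop 1] with m hm
  have hpos : 0 < 2 * Real.pi * (m : ℝ) := by
    have : (0 : ℝ) < m := by exact_mod_cast hm
    positivity
  rw [norm_mul, norm_inv, norm_two_pi_I_mul_natCast, inv_mul_eq_div]
  exact div_le_div_of_nonneg_right (norm_log_two_pi_I_mul_natCast_le hm) hpos.le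

include hβ hK

/-- `μ = 1/(2πiK) → 0`. [folklore] -/
theorem tendsto_param_mu : Tendsto (fun m : ℕ => (2 * Real.pi * I * (K m : ℂ))⁻¹) atTop (𝓝 0) := by
  rw [tendsto_zero_iff_norm_tendsto_zero]
  have hKt := tendsto_atTop_of_rpow_le hβ (fun m => (hK m).1)
  have h : Tendsto (fun m : ℕ => 2 * Real.pi * K m) atTop atTop := hKt.const_mul_atTop (by positivity)
  refine (h.inv_tendsto_atTop).congr' ?_
  filter_upwards [eventually_ge_atTop 1] with m hm
  have hKpos : 0 < K m := by linarith [one_le_of_rpow_le hβ (fun m => (hK m).1) hm]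
  rw [norm_inv, norm_mul, norm_mul, norm_mul, Complex.norm_I, mul_one, Complex.norm_real,
    Complex.norm_two, Real.norm_of_nonneg Real.pi_pos.le, Complex.norm_real,
    Real.norm_of_nonneg hKpos.le]
  simp

include hr₀ ha₀

/-- `σ = e^{-τ/e₀} → 0`, `τ = Log(2πiK/(r₀a₀))`. [folklore] -/
theorem tendsto_param_sigma (e₀ : ℕ) (he₀ : 1 ≤ e₀) :
    Tendsto (fun m : ℕ => exp (-(Complex.log (2 * Real.pi * I * (K m : ℂ) / ((r₀ : ℂ) * a₀))) /
      (e₀ : ℂ))) atTop (𝓝 0) := by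
  rw [tendsto_zero_iff_norm_tendsto_zero]
  have he : (0 : ℝ) < e₀ := by exact_mod_cast he₀
  have h := tendsto_exp_affine_log hβ hK (-(Real.log (2 * Real.pi / (|r₀| * ‖a₀‖))) / e₀)
    (-(1 / e₀)) 0 (by rw [add_zero, neg_mul, one_div_mul_eq_div]; exact neg_neg_of_pos (div_pos hβ he))
  refine h.congr' ?_
  filter_upwards [eventually_ge_atTop 1] with m hm
  have hKpos : 0 < K m := by linarith [one_le_of_rpow_le hβ (fun m => (hK m).1) hm]
  rw [Complex.norm_exp, Complex.div_natCast_re, Complex.neg_re, re_log_label_quot hKpos hr₀ ha₀]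
  congr 1
  ring

/-- `θ = e^{e₁τ/e₀}/(2πim) → 0` when `βe₁ < e₀`. [folklore] -/
theorem tendsto_param_theta (e₀ : ℕ) (he₀ : 1 ≤ e₀) (e₁ : ℕ) (hβ₁ : β * e₁ < e₀) :
    Tendsto (fun m : ℕ => (2 * Real.pi * I * (m : ℂ))⁻¹ *
      exp ((e₁ : ℂ) * Complex.log (2 * Real.pi * I * (K m : ℂ) / ((r₀ : ℂ) * a₀)) / (e₀ : ℂ)))
      atTop (𝓝 0) := by
  rw [tendsto_zero_iff_norm_tendsto_zero]
  have he : (0 : ℝ) < e₀ := by exact_mod_cast he₀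
  have h := tendsto_exp_affine_log hβ hK
    (-Real.log (2 * Real.pi) + (e₁ : ℝ) / e₀ * Real.log (2 * Real.pi / (|r₀| * ‖a₀‖)))
    ((e₁ : ℝ) / e₀) (-1) (by
      rw [div_mul_eq_mul_div, ← sub_eq_add_neg, sub_neg, div_lt_one he]; linarith)
  refine h.congr' ?_
  filter_upwards [eventually_ge_atTop 1] with m hm
  have hKpos : 0 < K m := by linarith [one_le_of_rpow_le hβ (fun m => (hK m).1) hm]
  have hmpos : (0 : ℝ) < m := by exact_mod_cast hm
  have h2pm : 0 < 2 * Real.pi * (m : ℝ) := by positivity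
  rw [norm_mul, norm_inv, norm_two_pi_I_mul_natCast, Complex.norm_exp, Complex.div_natCast_re,
    show ((e₁ : ℂ)) = ((e₁ : ℝ) : ℂ) by norm_cast, Complex.re_ofReal_mul,
    re_log_label_quot hKpos hr₀ ha₀, inv_mul_exp_eq_exp h2pm,
    Real.log_mul (by positivity) hmpos.ne']
  congr 1
  field_simp
  ring

/-- `η = r₀μe^{x₀ᶜ} → 0`, `x₀ᶜ = (-2πiK + τ/e₀ - r₁Log(2πim) - c)/r₀`, when `(β/e₀ - r₁)/r₀ < β`
(the cancelling condition). [folklore] -/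
theorem tendsto_param_eta (e₀ : ℕ) (he₀ : 1 ≤ e₀) (r₁ : ℝ) (c : ℂ)
    (hγ : (β / e₀ - r₁) / r₀ < β) :
    Tendsto (fun m : ℕ => (r₀ : ℂ) * (2 * Real.pi * I * (K m : ℂ))⁻¹ *
      exp ((-(2 * Real.pi * I * (K m : ℂ)) +
        Complex.log (2 * Real.pi * I * (K m : ℂ) / ((r₀ : ℂ) * a₀)) / (e₀ : ℂ) -
        (r₁ : ℂ) * Complex.log (2 * Real.pi * I * (m : ℂ)) - c) / (r₀ : ℂ))) atTop (𝓝 0) := by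
  rw [tendsto_zero_iff_norm_tendsto_zero]
  have he : (0 : ℝ) < e₀ := by exact_mod_cast he₀
  -- exponents: `b = 1/(e₀r₀) - 1`, `c' = -r₁/r₀`, `bβ + c' = (β/e₀ - r₁)/r₀ - β < 0`
  have h := tendsto_exp_affine_log hβ hK
    (Real.log (|r₀| / (2 * Real.pi)) +
      (Real.log (2 * Real.pi / (|r₀| * ‖a₀‖)) / e₀ - r₁ * Real.log (2 * Real.pi) - c.re) / r₀)
    (1 / (e₀ * r₀) - 1) (-r₁ / r₀) (by
      have : (1 / (e₀ * r₀) - 1) * β + -r₁ / r₀ = (β / e₀ - r₁) / r₀ - β := by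
        field_simp
        ring
      rw [this]; linarith)
  refine h.congr' ?_
  filter_upwards [eventually_ge_atTop 1] with m hm
  have hKpos : 0 < K m := by linarith [one_le_of_rpow_le hβ (fun m => (hK m).1) hm]
  have hmpos : (0 : ℝ) < m := by exact_mod_cast hm
  have h2pK : 0 < 2 * Real.pi * K m := by positivity
  rw [norm_mul, norm_mul, norm_inv, Complex.norm_real, Real.norm_eq_abs, Complex.norm_exp,
    Complex.div_ofReal_re, Complex.sub_re, Complex.sub_re, Complex.add_re, Complex.neg_re,
    re_two_pi_I_mul_ofReal, Complex.div_natCast_re, re_log_label_quot hKpos hr₀ ha₀,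
    Complex.re_ofReal_mul, re_log_two_pi_I_mul_natCast,
    Real.log_mul (by positivity) hmpos.ne']
  rw [show ‖2 * Real.pi * I * (K m : ℂ)‖ = 2 * Real.pi * K m by
    rw [norm_mul, norm_mul, norm_mul, Complex.norm_I, mul_one, Complex.norm_real, Complex.norm_two,
      Real.norm_of_nonneg Real.pi_pos.le, Complex.norm_real, Real.norm_of_nonneg hKpos.le]]
  rw [mul_inv_mul_exp_eq_exp (abs_pos.2 hr₀) h2pK, Real.log_mul (by positivity) hKpos.ne',
    Real.log_div (abs_pos.2 hr₀).ne' (by positivity)]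
  congr 1
  field_simp
  ring

/-- `ν = μ(τ/e₀ - r₁Log(2πim) - c) → 0`. [folklore] -/
theorem tendsto_param_nu (e₀ : ℕ) (he₀ : 1 ≤ e₀) (r₁ : ℝ) (c : ℂ) :
    Tendsto (fun m : ℕ => (2 * Real.pi * I * (K m : ℂ))⁻¹ *
      (Complex.log (2 * Real.pi * I * (K m : ℂ) / ((r₀ : ℂ) * a₀)) / (e₀ : ℂ) -
        (r₁ : ℂ) * Complex.log (2 * Real.pi * I * (m : ℂ)) - c)) atTop (𝓝 0) := by
  have he : (0 : ℝ) < e₀ := by exact_mod_cast he₀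
  have hK1 : ∀ m : ℕ, (m : ℝ) ^ β ≤ K m := fun m => (hK m).1
  set C₁ : ℝ := 2 * Real.pi / (|r₀| * ‖a₀‖) with hC₁
  have hC₁pos : 0 < C₁ := div_pos (by positivity) (mul_pos (abs_pos.2 hr₀) (norm_pos_iff.2 ha₀))
  -- the dominating sequence
  have hup : Tendsto (fun m : ℕ => ((|Real.log C₁| + Real.log (K m) + Real.pi) / e₀ +
      |r₁| * (|Real.log (2 * Real.pi)| + Real.log m + Real.pi) + ‖c‖) / (2 * Real.pi * K m)) atTop
      (𝓝 0) := by
    have e1 : ∀ m : ℕ, ((|Real.log C₁| + Real.log (K m) + Real.pi) / e₀ +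
        |r₁| * (|Real.log (2 * Real.pi)| + Real.log m + Real.pi) + ‖c‖) / (2 * Real.pi * K m) =
        (1 / (2 * Real.pi * e₀)) * (Real.log (K m) / K m) +
        (|r₁| / (2 * Real.pi)) * (Real.log m / K m) +
        (((|Real.log C₁| + Real.pi) / e₀ + |r₁| * (|Real.log (2 * Real.pi)| + Real.pi) + ‖c‖) /
          (2 * Real.pi)) / K m := by
      intro m
      field_simp
      ring
    simp_rw [e1]
    have h1 := (tendsto_log_div_label hβ hK1).const_mul (1 / (2 * Real.pi * e₀))
    have h2 := (tendsto_log_nat_div_label hβ hK1).const_mul (|r₁| / (2 * Real.pi))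
    have h3 := tendsto_const_div_label hβ hK1
      (((|Real.log C₁| + Real.pi) / e₀ + |r₁| * (|Real.log (2 * Real.pi)| + Real.pi) + ‖c‖) /
        (2 * Real.pi))
    simpa using (h1.add h2).add h3
  refine squeeze_zero_norm' ?_ hup
  filter_upwards [eventually_ge_atTop 1] with m hm
  have hK1m : 1 ≤ K m := one_le_of_rpow_le hβ hK1 hm
  have hKpos : 0 < K m := by linarith
  have hmpos : (0 : ℝ) < m := by exact_mod_cast hm
  have h2pK : 0 < 2 * Real.pi * K m := by positivity
  have hnK : ‖2 * Real.pi * I * (K m : ℂ)‖ = 2 * Real.pi * K m := by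
    rw [norm_mul, norm_mul, norm_mul, Complex.norm_I, mul_one, Complex.norm_real, Complex.norm_two,
      Real.norm_of_nonneg Real.pi_pos.le, Complex.norm_real, Real.norm_of_nonneg hKpos.le]
  -- `‖τ‖ ≤ |log C₁| + log K + π`
  have hq1 : 1 ≤ ‖2 * Real.pi * I * (K m : ℂ) / ((r₀ : ℂ) * a₀)‖ ∨
      ‖2 * Real.pi * I * (K m : ℂ) / ((r₀ : ℂ) * a₀)‖ < 1 := le_or_gt _ _
  have hτ : ‖Complex.log (2 * Real.pi * I * (K m : ℂ) / ((r₀ : ℂ) * a₀))‖ ≤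
      |Real.log C₁| + Real.log (K m) + Real.pi := by
    have h1 := Complex.norm_le_abs_re_add_abs_im
      (Complex.log (2 * Real.pi * I * (K m : ℂ) / ((r₀ : ℂ) * a₀)))
    rw [re_log_label_quot hKpos hr₀ ha₀, Complex.log_im] at h1
    have h2 : |Real.log C₁ + Real.log (K m)| ≤ |Real.log C₁| + Real.log (K m) := by
      have := abs_add_le (Real.log C₁) (Real.log (K m))
      rwa [abs_of_nonneg (Real.log_nonneg hK1m)] at this
    have h3 := Complex.abs_arg_le_pi (2 * Real.pi * I * (K m : ℂ) / ((r₀ : ℂ) * a₀))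
    rw [hC₁] at h2 ⊢
    linarith
  have hΛ : ‖Complex.log (2 * Real.pi * I * (m : ℂ))‖ ≤
      |Real.log (2 * Real.pi)| + Real.log m + Real.pi := by
    have := norm_log_two_pi_I_mul_natCast_le hm
    rw [Real.log_mul (by positivity) hmpos.ne'] at this
    linarith [le_abs_self (Real.log (2 * Real.pi))]
  rw [norm_mul, norm_inv, hnK, inv_mul_eq_div]
  refine div_le_div_of_nonneg_right ?_ h2pK.le
  calc ‖Complex.log (2 * Real.pi * I * (K m : ℂ) / ((r₀ : ℂ) * a₀)) / (e₀ : ℂ) -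
        (r₁ : ℂ) * Complex.log (2 * Real.pi * I * (m : ℂ)) - c‖
      ≤ ‖Complex.log (2 * Real.pi * I * (K m : ℂ) / ((r₀ : ℂ) * a₀)) / (e₀ : ℂ)‖ +
          ‖(r₁ : ℂ) * Complex.log (2 * Real.pi * I * (m : ℂ))‖ + ‖c‖ := by
        refine (norm_sub_le _ _).trans ?_
        gcongr
        exact norm_sub_le _ _
    _ ≤ (|Real.log C₁| + Real.log (K m) + Real.pi) / e₀ +
          |r₁| * (|Real.log (2 * Real.pi)| + Real.log m + Real.pi) + ‖c‖ := by
        gcongr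
        · rw [norm_div, Complex.norm_natCast]
          exact div_le_div_of_nonneg_right hτ he.le
        · rw [norm_mul, Complex.norm_real, Real.norm_eq_abs]
          exact mul_le_mul_of_nonneg_left hΛ (abs_nonneg _)

end Params

end Summit.Schanuel.Schanuel.Theorems

end
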